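import Literature.NumberTheory.LFunctions.RayClassLFunctionImprimitive
import Literature.NumberTheory.LFunctions.RayClassLSeriesNonvanishingLineProofs
import Literature.NumberTheory.LFunctions.ClassGroupXi
import HarnessLib

/-!
# The entire completion `ξ(s, χ) = s(s−1) (|d_K|N𝔣)^{s/2} L_∞(χ, s) L(s, χ)` of the Hecke `L`-function of a
# primitive ray class character

Topic `Literature/NumberTheory/LFunctions` (namespace `Literature.NumberTheory.LFunctions`), the ray-class
counterpart (conductor `𝔣`, sign type `p`) of the tree's `ClassGroupXi.lean` (conductor `1`).  Everything here is
PROVED; `RayXiData` is a structure (analytic data), `rayCond`, `rayXiG`, `RayXiData.xi`, `RayXiData.swap` are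
definitions with bodies.

For a primitive ray class character `χ mod 𝔣` of sign type `p` of the number field `K`, NON-PRINCIPAL (so that
`L(s, χ)` is entire — Hecke), put `A = |d_K| N𝔣` and, for an entire `L`,
`G_L(s) = s(s−1) · A^{s/2} L_∞(χ, s) · L(s)` (`rayXiG`; `L_∞ = rayClassGammaFactor K p`), holomorphic on `Re s > 0`.
A `RayXiData K 𝔣 p` packages two entire functions `L, L'` (the continuations of `L(s,χ)` and `L(s, χ̄)`) and a
root number `W`, `|W| = 1`, with the functional equation `G_L(1 − s) = W G_{L'}(s)` on the open strip
`0 < Re s < 1` (Neukirch VII (8.6) transferred to the entire continuations by the identity theorem);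
`RayClassPrimitiveData.xiData` CONSTRUCTS it from the tree's primitive data and Hecke's functional equation
(`rayClassLSeries_functional_equation'`), with `L' = conj ∘ L ∘ conj`.  Gluing along `Re s = 1/2` gives the ENTIRE
function (`RayXiData.xi`)

  `ξ(s) = G_L(s)` (`Re s ≥ 1/2`), `= W G_{L'}(1 − s)` (`Re s < 1/2`),

with `ξ(1 − s) = W ξ̃(s)` for the swapped data `(L', L, W⁻¹)` and ALL `s`, `ξ(s) = G_L(s)` for `Re s > 0`, growth
`‖ξ(s)‖ ≤ C exp(‖s‖^{15/8})`, zeros in `0 ≤ Re s ≤ 1`, `ξ(1) = ξ(0) = 0`, and every zero `ρ` of `L` with `Re ρ > 0`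
a zero of `ξ`.  This is [cite: ThornerZaman2017, §2.2] ("`ξ(s,χ)` is entire of order 1 and satisfies
`ξ(s,χ) = w(χ)ξ(1−s,χ̄)`") for `χ ≠ 1` (there `ξ = [s(s−1)]^{δ(χ)} D_χ^{s/2} γ_χ L`; we keep the harmless factor
`s(s−1)` for every `χ`, which adds the zeros `{0, 1}` and makes the four slots of the Deuring–Heilbronn family
uniform), [cite: NeukirchANT1999, Ch. VII §8 Cor. (8.6)], [cite: LagariasMontgomeryOdlyzko1979, §3].

## References
* J. Neukirch, *Algebraic Number Theory*, Springer 1999, VII (8.5)–(8.6). [NeukirchANT1999]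
* J. Thorner, A. Zaman, Algebra Number Theory 11 (2017), §2. [ThornerZaman2017]
* J. C. Lagarias, H. L. Montgomery, A. M. Odlyzko, Invent. Math. 54 (1979), §3. [LagariasMontgomeryOdlyzko1979]
-/

noncomputable section

open scoped NumberField ComplexConjugate
open Complex Filter Topology Set Metric NumberField NumberField.InfinitePlace IsDedekindDomain

namespace Literature.NumberTheory.LFunctions

open Literature.NumberTheory.LFunctions.NumberField

variable (K : Type*) [Field K] [NumberField K]

/-! ### The conductor–discriminant `A = |d_K| N𝔣` and `G_L(s) = s(s−1) A^{s/2} L_∞(s) L(s)` -/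

/-- `A = |d_K| · N𝔣` (`D_χ = D_K N𝔣_χ`). [cite: ThornerZaman2017, §2.2] -/
def rayCond (𝔣 : Ideal (𝓞 K)) : ℝ := |(discr K : ℝ)| * (Ideal.absNorm 𝔣 : ℝ)

/-- `G_L(s) = s(s−1) · A^{s/2} L_∞(χ,s) · L(s)`; for `L = L(·, χ)` on `Re s > 1` this is `s(s−1)Λ(χ, s)`
(`completedRayClassL`). [cite: NeukirchANT1999, Ch. VII §8 Cor. (8.6)] -/
def rayXiG (𝔣 : Ideal (𝓞 K)) (p : Finset {w : InfinitePlace K // IsReal w}) (L : ℂ → ℂ) (s : ℂ) : ℂ :=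
  s * (s - 1) * (((rayCond K 𝔣 : ℝ) : ℂ) ^ (s / 2) * rayClassGammaFactor K p s * L s)

variable {K}
variable {𝔣 : Ideal (𝓞 K)} {p : Finset {w : InfinitePlace K // IsReal w}}

/-- `A ≥ 1` for `𝔣 ≠ 0`. [cite: ThornerZaman2017, §2.2] -/
theorem one_le_rayCond (h𝔣 : 𝔣 ≠ ⊥) : 1 ≤ rayCond K 𝔣 := by
  have hd : (1 : ℝ) ≤ |(discr K : ℝ)| := by
    have h := Int.one_le_abs (discr_ne_zero K)
    rw [← Int.cast_abs]; exact_mod_cast h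
  have hm : (1 : ℝ) ≤ (Ideal.absNorm 𝔣 : ℝ) := by
    have : 1 ≤ Ideal.absNorm 𝔣 := Nat.one_le_iff_ne_zero.mpr (by rwa [Ne, Ideal.absNorm_eq_zero_iff])
    exact_mod_cast this
  rw [rayCond]; nlinarith

/-- `G_L(s) = s(s−1)Λ(χ,s)` on `Re s > 1` when `L` continues `L(χ, ·)`. [cite: NeukirchANT1999, Ch. VII §8 Cor. (8.6)] -/
theorem rayXiG_eq_completed {χ : HeightOneSpectrum (𝓞 K) → ℂ} {L : ℂ → ℂ}
    (hL : ∀ s : ℂ, 1 < s.re → L s = rayClassLSeries 𝔣 χ s) {s : ℂ} (hs : 1 < s.re) :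
    rayXiG K 𝔣 p L s = s * (s - 1) * completedRayClassL K 𝔣 χ p s := by
  rw [rayXiG, completedRayClassL, hL s hs, rayCond]

/-- `L_∞(χ, ·)` is differentiable at every `s` with `Re s > 0` (it is the inverse of an entire function and
does not vanish there). [cite: NeukirchANT1999, Ch. VII §8 (8.3) Proposition] -/
theorem differentiableAt_rayClassGammaFactor_of_re_pos (p : Finset {w : InfinitePlace K // IsReal w}) {s : ℂ}
    (hs : 0 < s.re) : DifferentiableAt ℂ (rayClassGammaFactor K p) s := by
  have hne : ∀ z : ℂ, 0 < z.re → rayClassGammaFactor K p z ≠ 0 := fun z hz ↦ by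
    rw [rayClassGammaFactor_eq]
    refine mul_ne_zero (pow_ne_zero _ two_ne_zero) (NumberField.gammaFactorCP_ne_zero p ?_)
    simp only [Complex.div_ofNat_re]; linarith
  have hinv : Differentiable ℂ fun z : ℂ ↦ (rayClassGammaFactor K p z)⁻¹ := by
    have heq : (fun z : ℂ ↦ (rayClassGammaFactor K p z)⁻¹) =
        fun z ↦ ((2 : ℂ) ^ nrComplexPlaces K)⁻¹ * (NumberField.gammaFactorCP K p (z / 2))⁻¹ := by
      funext z; rw [rayClassGammaFactor_eq, mul_inv]
    rw [heq]
    exact (differentiable_const _).mul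
      ((NumberField.differentiable_inv_gammaFactorCP p).comp (differentiable_id.div_const 2))
  have h := (hinv s).inv (inv_ne_zero (hne s hs))
  exact h.congr_of_eventuallyEq (Filter.Eventually.of_forall fun z ↦ by simp)

/-- `L_∞(χ, s) ≠ 0` for `Re s > 0`. [cite: NeukirchANT1999, Ch. VII §8 (8.3) Proposition] -/
theorem rayClassGammaFactor_ne_zero (p : Finset {w : InfinitePlace K // IsReal w}) {s : ℂ} (hs : 0 < s.re) :
    rayClassGammaFactor K p s ≠ 0 := by
  rw [rayClassGammaFactor_eq]
  refine mul_ne_zero (pow_ne_zero _ two_ne_zero) (NumberField.gammaFactorCP_ne_zero p ?_)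
  simp only [Complex.div_ofNat_re]; linarith

/-- `G_L` is differentiable on `Re s > 0` for entire `L`. [cite: NeukirchANT1999, Ch. VII §8 Cor. (8.6)] -/
theorem differentiableAt_rayXiG {L : ℂ → ℂ} (hL : Differentiable ℂ L) (h𝔣 : 𝔣 ≠ ⊥) {s : ℂ} (hs : 0 < s.re) :
    DifferentiableAt ℂ (rayXiG K 𝔣 p L) s := by
  have hA : ((rayCond K 𝔣 : ℝ) : ℂ) ≠ 0 :=
    Complex.ofReal_ne_zero.mpr (by linarith [one_le_rayCond (K := K) h𝔣])
  have h1 : DifferentiableAt ℂ (fun z : ℂ ↦ ((rayCond K 𝔣 : ℝ) : ℂ) ^ (z / 2)) s :=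
    (differentiableAt_id.div_const 2).const_cpow (Or.inl hA)
  unfold rayXiG
  exact (differentiableAt_id.mul (differentiableAt_id.sub_const 1)).mul
    ((h1.mul (differentiableAt_rayClassGammaFactor_of_re_pos p hs)).mul (hL s))

/-- `G_L(s) ≠ 0` for `Re s > 1` when `L(s) ≠ 0` there. [cite: NeukirchANT1999, Ch. VII §8 Cor. (8.6)] -/
theorem rayXiG_ne_zero {L : ℂ → ℂ} (h𝔣 : 𝔣 ≠ ⊥) {s : ℂ} (hs : 1 < s.re) (hL : L s ≠ 0) :
    rayXiG K 𝔣 p L s ≠ 0 := by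
  have hA : ((rayCond K 𝔣 : ℝ) : ℂ) ≠ 0 :=
    Complex.ofReal_ne_zero.mpr (by linarith [one_le_rayCond (K := K) h𝔣])
  have hs1 : s ≠ 1 := fun h ↦ by rw [h, one_re] at hs; exact lt_irrefl _ hs
  have hs0 : s ≠ 0 := fun h ↦ by rw [h, zero_re] at hs; linarith
  have hc : ((rayCond K 𝔣 : ℝ) : ℂ) ^ (s / 2) ≠ 0 := by
    rw [Ne, cpow_eq_zero_iff, not_and_or]; exact Or.inl hA
  unfold rayXiG
  exact mul_ne_zero (mul_ne_zero hs0 (sub_ne_zero.mpr hs1))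
    (mul_ne_zero (mul_ne_zero hc (rayClassGammaFactor_ne_zero p (by linarith))) hL)

/-- `G_L(1) = 0` (the factor `s − 1`). [cite: ThornerZaman2017, §2.2] -/
theorem rayXiG_one (L : ℂ → ℂ) : rayXiG K 𝔣 p L 1 = 0 := by simp [rayXiG]

/-- A zero of `L` is a zero of `G_L`. [cite: ThornerZaman2017, §2.2] -/
theorem rayXiG_eq_zero_of_eq_zero {L : ℂ → ℂ} {ρ : ℂ} (h : L ρ = 0) : rayXiG K 𝔣 p L ρ = 0 := by
  simp [rayXiG, h]

/-! ### Growth of `L_∞` and of `G_L` on `Re s ≥ 1/2` -/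

/-- **Growth of the Gamma factor on `Re s ≥ 1/2`**: `|L_∞(χ, s)| ≤ 4^{r₁} 8^{r₂} exp(2(r₁ + r₂) y^{3/2})`,
`y = |s| + 5/2` (each `Γ_ℝ(s + p_w) ≤ 4 e^{2Y}`, each `Γ_ℂ(s) ≤ 8 e^{2Y}`).
[cite: NeukirchANT1999, Ch. VII §8 (8.3) Proposition] -/
theorem norm_rayClassGammaFactor_le (p : Finset {w : InfinitePlace K // IsReal w}) {s : ℂ} (hs : 1 / 2 ≤ s.re) :
    ‖rayClassGammaFactor K p s‖ ≤ 4 ^ nrRealPlaces K * 8 ^ nrComplexPlaces K *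
      Real.exp ((2 * nrRealPlaces K + 2 * nrComplexPlaces K) * (‖s‖ + 5 / 2) ^ (3 / 2 : ℝ)) := by
  classical
  set y : ℝ := ‖s‖ + 5 / 2 with hy
  set Y : ℝ := y ^ (3 / 2 : ℝ) with hY
  have hy1 : 1 ≤ y := by rw [hy]; linarith [norm_nonneg s]
  -- the real places
  have hR : ∀ w : {w : InfinitePlace K // IsReal w},
      ‖Gammaℝ (s + 2 * (NumberField.halfWeight K p w.1 : ℂ))‖ ≤ 4 * Real.exp (2 * Y) := by
    intro w
    have hh0 := NumberField.halfWeight_nonneg (K := K) p w.1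
    have hh1 : NumberField.halfWeight K p w.1 ≤ 1 / 2 := by
      unfold NumberField.halfWeight; split_ifs <;> norm_num
    set u : ℂ := s + 2 * (NumberField.halfWeight K p w.1 : ℂ) with hu
    have hure : u.re = s.re + 2 * NumberField.halfWeight K p w.1 := by
      simp [hu]
    have h1 := norm_Gammaℝ_le_norm_Gamma (s := u) (by rw [hure]; linarith)
    have h2 := norm_Gamma_le_exp_rpow_of_quarter_le_re (w := u / 2)
      (by rw [Complex.div_ofNat_re, hure]; linarith)
    have h3 : (‖u / 2‖ + 1) ^ (3 / 2 : ℝ) ≤ Y := by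
      rw [hY]
      apply Real.rpow_le_rpow (by positivity) _ (by norm_num)
      rw [norm_div, hy]
      have : ‖(2 : ℂ)‖ = 2 := by simp
      rw [this]
      have hun : ‖u‖ ≤ ‖s‖ + 1 := by
        rw [hu]
        calc ‖s + 2 * (NumberField.halfWeight K p w.1 : ℂ)‖
            ≤ ‖s‖ + ‖(2 : ℂ) * (NumberField.halfWeight K p w.1 : ℂ)‖ := norm_add_le _ _
          _ = ‖s‖ + 2 * NumberField.halfWeight K p w.1 := by
              rw [norm_mul, this, Complex.norm_real, Real.norm_of_nonneg hh0]
          _ ≤ ‖s‖ + 1 := by linarith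
      linarith [norm_nonneg s]
    calc ‖Gammaℝ u‖ ≤ ‖Complex.Gamma (u / 2)‖ := h1
      _ ≤ 4 * Real.exp (2 * (‖u / 2‖ + 1) ^ (3 / 2 : ℝ)) := h2
      _ ≤ 4 * Real.exp (2 * Y) := by gcongr
  -- the complex places
  have hC : ‖Gammaℂ s‖ ≤ 8 * Real.exp (2 * Y) := by
    have h1 := norm_Gammaℂ_le_norm_Gamma (s := s) (by linarith)
    have h2 := norm_Gamma_le_exp_rpow_of_quarter_le_re (w := s) (by linarith)
    have h3 : (‖s‖ + 1) ^ (3 / 2 : ℝ) ≤ Y := by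
      rw [hY]
      exact Real.rpow_le_rpow (by positivity) (by rw [hy]; linarith) (by norm_num)
    calc ‖Gammaℂ s‖ ≤ 2 * ‖Complex.Gamma s‖ := h1
      _ ≤ 2 * (4 * Real.exp (2 * (‖s‖ + 1) ^ (3 / 2 : ℝ))) := by gcongr
      _ ≤ 2 * (4 * Real.exp (2 * Y)) := by gcongr
      _ = 8 * Real.exp (2 * Y) := by ring
  -- assemble
  rw [rayClassGammaFactor, norm_mul]
  have hRprod : ‖∏ w : {w : InfinitePlace K // IsReal w}, Gammaℝ (s + 2 * (NumberField.halfWeight K p w.1 : ℂ))‖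
      ≤ (4 * Real.exp (2 * Y)) ^ nrRealPlaces K := by
    refine (Finset.norm_prod_le _ _).trans ?_
    calc ∏ w : {w : InfinitePlace K // IsReal w}, ‖Gammaℝ (s + 2 * (NumberField.halfWeight K p w.1 : ℂ))‖
        ≤ ∏ _w : {w : InfinitePlace K // IsReal w}, (4 * Real.exp (2 * Y)) :=
          Finset.prod_le_prod (fun w _ ↦ norm_nonneg _) fun w _ ↦ hR w
      _ = (4 * Real.exp (2 * Y)) ^ nrRealPlaces K := by
          rw [Finset.prod_const, Finset.card_univ, nrRealPlaces]
  have hCprod : ‖∏ _w : {w : InfinitePlace K // IsComplex w}, Gammaℂ s‖ ≤ (8 * Real.exp (2 * Y)) ^ nrComplexPlaces K := by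
    refine (Finset.norm_prod_le _ _).trans ?_
    calc ∏ _w : {w : InfinitePlace K // IsComplex w}, ‖Gammaℂ s‖
        ≤ ∏ _w : {w : InfinitePlace K // IsComplex w}, (8 * Real.exp (2 * Y)) :=
          Finset.prod_le_prod (fun w _ ↦ norm_nonneg _) fun w _ ↦ hC
      _ = (8 * Real.exp (2 * Y)) ^ nrComplexPlaces K := by
          rw [Finset.prod_const, Finset.card_univ, nrComplexPlaces]
  calc ‖∏ w : {w : InfinitePlace K // IsReal w}, Gammaℝ (s + 2 * (NumberField.halfWeight K p w.1 : ℂ))‖ *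
        ‖∏ _w : {w : InfinitePlace K // IsComplex w}, Gammaℂ s‖
      ≤ (4 * Real.exp (2 * Y)) ^ nrRealPlaces K * (8 * Real.exp (2 * Y)) ^ nrComplexPlaces K :=
        mul_le_mul hRprod hCprod (norm_nonneg _) (by positivity)
    _ = 4 ^ nrRealPlaces K * 8 ^ nrComplexPlaces K *
        Real.exp ((2 * nrRealPlaces K + 2 * nrComplexPlaces K) * Y) := by
        rw [mul_pow, mul_pow, ← Real.exp_nat_mul, ← Real.exp_nat_mul]
        have : (2 * nrRealPlaces K + 2 * nrComplexPlaces K) * Y =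
            nrRealPlaces K * (2 * Y) + nrComplexPlaces K * (2 * Y) := by ring
        rw [this, Real.exp_add]
        ring

/-- **Growth of `G_L` on `Re s ≥ 1/2`**: if `|L(s)| ≤ C_L (|s| + 5/2)^n` there, then
`‖G_L(s)‖ ≤ C exp(‖s‖^{7/4})`. [cite: ThornerZaman2017, §2.2] -/
theorem exists_norm_rayXiG_le (h𝔣 : 𝔣 ≠ ⊥) {L : ℂ → ℂ} {C_L : ℝ} (hC_L : 0 ≤ C_L)
    (hL : ∀ s : ℂ, 1 / 2 ≤ s.re → ‖L s‖ ≤ C_L * (‖s‖ + 5 / 2) ^ Module.finrank ℚ K) :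
    ∃ C : ℝ, 0 ≤ C ∧ ∀ s : ℂ, 1 / 2 ≤ s.re →
      ‖rayXiG K 𝔣 p L s‖ ≤ C * Real.exp (‖s‖ ^ (7 / 4 : ℝ)) := by
  set A : ℝ := rayCond K 𝔣 with hAdef
  have hA1 : 1 ≤ A := one_le_rayCond (K := K) h𝔣
  have hlogA : 0 ≤ Real.log A := Real.log_nonneg hA1
  set n : ℕ := Module.finrank ℚ K with hn
  set r₁ : ℕ := nrRealPlaces K with hr₁
  set r₂ : ℕ := nrComplexPlaces K with hr₂
  set k : ℝ := 2 + n + (Real.log A + 2 * r₁ + 2 * r₂) with hk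
  have hk0 : 0 ≤ k := by rw [hk]; positivity
  set C₀ : ℝ := C_L * (4 ^ r₁ * 8 ^ r₂) with hC₀
  have hC₀0 : 0 ≤ C₀ := by rw [hC₀]; positivity
  obtain ⟨B, hB0, hB⟩ := Stark1974.exists_mul_add_rpow_le (μ := 3 / 2) (μ' := 7 / 4) (c := k)
    (a := 5 / 2) (by norm_num) (by norm_num) hk0 (by norm_num)
  refine ⟨C₀ * Real.exp B, by positivity, fun s hs ↦ ?_⟩
  set y : ℝ := ‖s‖ + 5 / 2 with hy
  set Y : ℝ := y ^ (3 / 2 : ℝ) with hY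
  have hy1 : 1 ≤ y := by rw [hy]; linarith [norm_nonneg s]
  have hy0 : 0 ≤ y := by linarith
  have hyY : y ≤ Y := le_rpow_three_halves hy1
  have hY0 : 0 ≤ Y := by linarith
  have hexpY : y ≤ Real.exp Y := hyY.trans (by linarith [Real.add_one_le_exp Y])
  -- `|s(s−1)| ≤ y² ≤ exp(2Y)`
  have hf1 : ‖s‖ * ‖s - 1‖ ≤ Real.exp (2 * Y) := by
    have h1 : ‖s‖ ≤ y := by rw [hy]; linarith
    have h2 : ‖s - 1‖ ≤ y := by
      calc ‖s - 1‖ ≤ ‖s‖ + ‖(1 : ℂ)‖ := norm_sub_le _ _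
        _ ≤ y := by rw [norm_one, hy]; linarith
    calc ‖s‖ * ‖s - 1‖ ≤ y * y := mul_le_mul h1 h2 (norm_nonneg _) hy0
      _ ≤ Real.exp Y * Real.exp Y := mul_le_mul hexpY hexpY hy0 (Real.exp_pos _).le
      _ = Real.exp (2 * Y) := by rw [two_mul, Real.exp_add]
  -- `|A^{s/2}| ≤ exp(log A · Y)`
  have hf2 : ‖((A : ℝ) : ℂ) ^ (s / 2)‖ ≤ Real.exp (Real.log A * Y) := by
    rw [Complex.norm_cpow_eq_rpow_re_of_pos (by linarith) (s / 2), Real.rpow_def_of_pos (by linarith)]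
    apply Real.exp_le_exp.mpr
    have h1 : (s / 2).re ≤ Y := by
      rw [Complex.div_ofNat_re]
      have := Complex.re_le_norm s
      linarith
    exact mul_le_mul_of_nonneg_left h1 hlogA
  -- the Gamma factor
  have hf3 := norm_rayClassGammaFactor_le (K := K) p hs
  rw [← hr₁, ← hr₂, ← hy, ← hY] at hf3
  -- `|L(s)| ≤ C_L y^n ≤ C_L exp(n Y)`
  have hf4 : ‖L s‖ ≤ C_L * Real.exp (n * Y) := by
    calc ‖L s‖ ≤ C_L * y ^ n := by rw [hy, hn]; exact hL s hs
      _ ≤ C_L * Real.exp (n * Y) := by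
          gcongr
          calc y ^ n ≤ (Real.exp Y) ^ n := pow_le_pow_left₀ hy0 hexpY n
            _ = Real.exp (n * Y) := by rw [← Real.exp_nat_mul]
  have hprod : ‖rayXiG K 𝔣 p L s‖ ≤ C₀ * Real.exp (k * Y) := by
    rw [rayXiG, ← hAdef, norm_mul, norm_mul, norm_mul, norm_mul]
    calc ‖s‖ * ‖s - 1‖ * (‖((A : ℝ) : ℂ) ^ (s / 2)‖ * ‖rayClassGammaFactor K p s‖ * ‖L s‖)
        ≤ Real.exp (2 * Y) * (Real.exp (Real.log A * Y) *
            (4 ^ r₁ * 8 ^ r₂ * Real.exp ((2 * r₁ + 2 * r₂) * Y)) * (C_L * Real.exp (n * Y))) := by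
          gcongr
      _ = C₀ * Real.exp (k * Y) := by
          rw [hC₀, hk]
          have : (2 + (n : ℝ) + (Real.log A + 2 * r₁ + 2 * r₂)) * Y =
              2 * Y + Real.log A * Y + (2 * r₁ + 2 * r₂) * Y + n * Y := by ring
          rw [this, Real.exp_add, Real.exp_add, Real.exp_add]
          ring
  have hkY : k * Y ≤ ‖s‖ ^ (7 / 4 : ℝ) + B := by
    have := hB ‖s‖ (norm_nonneg s)
    rw [hY, hy, show ‖s‖ + 5 / 2 = 5 / 2 + ‖s‖ by ring]
    exact this
  calc ‖rayXiG K 𝔣 p L s‖ ≤ C₀ * Real.exp (k * Y) := hprod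
    _ ≤ C₀ * Real.exp (‖s‖ ^ (7 / 4 : ℝ) + B) := by gcongr
    _ = C₀ * Real.exp B * Real.exp (‖s‖ ^ (7 / 4 : ℝ)) := by rw [Real.exp_add]; ring

/-! ### The analytic data `(L, L', W)` and the entire function `ξ` -/

variable (K) in
/-- **Analytic data of a completed Hecke `L`-function of conductor `𝔣` and sign type `p`**: two entire
functions `L, L'` (the continuations of `L(s,χ)` and `L(s,χ̄)`), of polynomial growth on `Re s ≥ 1/2` and
non-vanishing on `Re s > 1`, and a root number `W` of modulus `1`, with the functional equation
`G_L(1 − s) = W G_{L'}(s)` on the strip `0 < Re s < 1`. [cite: NeukirchANT1999, Ch. VII §8 Cor. (8.6)] -/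
structure RayXiData (𝔣 : Ideal (𝓞 K)) (p : Finset {w : InfinitePlace K // IsReal w}) where
  /-- the entire continuation of `L(s, χ)` -/
  L : ℂ → ℂ
  /-- the entire continuation of `L(s, χ̄)` -/
  L' : ℂ → ℂ
  /-- the root number -/
  W : ℂ
  ne_bot : 𝔣 ≠ ⊥
  differentiable_L : Differentiable ℂ L
  differentiable_L' : Differentiable ℂ L'
  norm_W : ‖W‖ = 1
  growth_L : ∃ C : ℝ, 0 ≤ C ∧ ∀ s : ℂ, 1 / 2 ≤ s.re → ‖L s‖ ≤ C * (‖s‖ + 5 / 2) ^ Module.finrank ℚ K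
  growth_L' : ∃ C : ℝ, 0 ≤ C ∧ ∀ s : ℂ, 1 / 2 ≤ s.re → ‖L' s‖ ≤ C * (‖s‖ + 5 / 2) ^ Module.finrank ℚ K
  L_ne_zero : ∀ s : ℂ, 1 < s.re → L s ≠ 0
  L'_ne_zero : ∀ s : ℂ, 1 < s.re → L' s ≠ 0
  fe : ∀ s : ℂ, 0 < s.re → s.re < 1 → rayXiG K 𝔣 p L (1 - s) = W * rayXiG K 𝔣 p L' s

namespace RayXiData

variable (T : RayXiData K 𝔣 p)

/-- `W ≠ 0`. [cite: NeukirchANT1999, Ch. VII §8 Thm. (8.5)] -/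
theorem W_ne_zero : T.W ≠ 0 := fun h ↦ by
  have := T.norm_W; rw [h, norm_zero] at this; exact zero_ne_one this

/-- **The swapped data `(L', L, W⁻¹)`** (the data of `χ̄`). [cite: NeukirchANT1999, Ch. VII §8 Cor. (8.6)] -/
def swap : RayXiData K 𝔣 p where
  L := T.L'
  L' := T.L
  W := T.W⁻¹
  ne_bot := T.ne_bot
  differentiable_L := T.differentiable_L'
  differentiable_L' := T.differentiable_L
  norm_W := by rw [norm_inv, T.norm_W, inv_one]
  growth_L := T.growth_L'
  growth_L' := T.growth_L
  L_ne_zero := T.L'_ne_zero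
  L'_ne_zero := T.L_ne_zero
  fe := fun s hs0 hs1 ↦ by
    have h := T.fe (1 - s) (by simp; linarith) (by simp; linarith)
    rw [sub_sub_cancel] at h
    rw [h, ← mul_assoc, inv_mul_cancel₀ T.W_ne_zero, one_mul]

/-- Unfolding `swap`. [cite: NeukirchANT1999, Ch. VII §8 Cor. (8.6)] -/
@[simp] theorem swap_L : T.swap.L = T.L' := rfl
/-- Unfolding `swap`. [cite: NeukirchANT1999, Ch. VII §8 Cor. (8.6)] -/
@[simp] theorem swap_L' : T.swap.L' = T.L := rfl
/-- Unfolding `swap`. [cite: NeukirchANT1999, Ch. VII §8 Cor. (8.6)] -/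
@[simp] theorem swap_W : T.swap.W = T.W⁻¹ := rfl
/-- `swap` is an involution. [cite: NeukirchANT1999, Ch. VII §8 Cor. (8.6)] -/
@[simp] theorem swap_swap : T.swap.swap = T := by
  cases T; simp [swap]

/-- **`ξ(s)`**: `G_L(s)` for `Re s ≥ 1/2` and `W G_{L'}(1 − s)` for `Re s < 1/2`.
[cite: NeukirchANT1999, Ch. VII §8 Cor. (8.6)] -/
def xi (s : ℂ) : ℂ :=
  if 1 / 2 ≤ s.re then rayXiG K 𝔣 p T.L s else T.W * rayXiG K 𝔣 p T.L' (1 - s)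

/-- `ξ(s) = G_L(s)` for `Re s > 0`. [cite: NeukirchANT1999, Ch. VII §8 Cor. (8.6)] -/
theorem xi_eq_of_re_pos {s : ℂ} (hs : 0 < s.re) : T.xi s = rayXiG K 𝔣 p T.L s := by
  by_cases h : 1 / 2 ≤ s.re
  · simp only [xi, h, if_true]
  · simp only [xi, h, if_false]
    push Not at h
    have := T.fe (1 - s) (by simp; linarith) (by simp; linarith)
    rw [sub_sub_cancel] at this
    exact this.symm

/-- `ξ(s) = W G_{L'}(1 − s)` for `Re s < 1`. [cite: NeukirchANT1999, Ch. VII §8 Cor. (8.6)] -/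
theorem xi_eq_of_re_lt_one {s : ℂ} (hs : s.re < 1) : T.xi s = T.W * rayXiG K 𝔣 p T.L' (1 - s) := by
  by_cases h : 1 / 2 ≤ s.re
  · simp only [xi, h, if_true]
    have := T.fe (1 - s) (by simp; linarith) (by simp; linarith)
    rw [sub_sub_cancel] at this
    exact this
  · simp only [xi, h, if_false]

/-- **`ξ` is entire.** [cite: NeukirchANT1999, Ch. VII §8 Thm. (8.5)] -/
theorem differentiable_xi : Differentiable ℂ T.xi := by
  intro s
  rcases lt_or_ge s.re (1 / 2) with h | h
  · have hev : T.xi =ᶠ[𝓝 s] fun z ↦ T.W * rayXiG K 𝔣 p T.L' (1 - z) := by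
      filter_upwards [(continuous_re.isOpen_preimage _ isOpen_Iio).mem_nhds
        (show s ∈ re ⁻¹' Iio 1 by simp; linarith)] with z hz
      exact T.xi_eq_of_re_lt_one (by simpa using hz)
    refine DifferentiableAt.congr_of_eventuallyEq ?_ hev
    have h1 : DifferentiableAt ℂ (rayXiG K 𝔣 p T.L') (1 - s) :=
      differentiableAt_rayXiG T.differentiable_L' T.ne_bot (by simp; linarith)
    exact (h1.comp s ((differentiableAt_const _).sub differentiableAt_id)).const_mul _
  · have hev : T.xi =ᶠ[𝓝 s] rayXiG K 𝔣 p T.L := by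
      filter_upwards [(continuous_re.isOpen_preimage _ isOpen_Ioi).mem_nhds
        (show s ∈ re ⁻¹' Ioi 0 by simp; linarith)] with z hz
      exact T.xi_eq_of_re_pos (by simpa using hz)
    exact (differentiableAt_rayXiG T.differentiable_L T.ne_bot (by linarith)).congr_of_eventuallyEq hev

/-- **Functional equation `ξ(1 − s) = W ξ̃(s)`** for all `s`, `ξ̃` the function of the swapped data.
[cite: NeukirchANT1999, Ch. VII §8 Cor. (8.6)] -/
theorem xi_one_sub (s : ℂ) : T.xi (1 - s) = T.W * T.swap.xi s := by
  rcases lt_or_ge s.re (1 / 2) with h | h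
  · rw [T.xi_eq_of_re_pos (by simp; linarith), T.swap.xi_eq_of_re_lt_one (by linarith), swap_W, swap_L',
      ← mul_assoc, mul_inv_cancel₀ T.W_ne_zero, one_mul]
  · rw [T.xi_eq_of_re_lt_one (by simp; linarith), sub_sub_cancel, T.swap.xi_eq_of_re_pos (by linarith), swap_L]

/-- **Growth**: `‖ξ(s)‖ ≤ C exp(‖s‖^{15/8})`. [cite: ThornerZaman2017, §2.2] -/
theorem exists_norm_xi_le : ∃ C : ℝ, 0 ≤ C ∧ ∀ s : ℂ, ‖T.xi s‖ ≤ C * Real.exp (‖s‖ ^ (15 / 8 : ℝ)) := by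
  obtain ⟨CL, hCL0, hCL⟩ := T.growth_L
  obtain ⟨CL', hCL'0, hCL'⟩ := T.growth_L'
  obtain ⟨C₁, hC₁0, hC₁⟩ := exists_norm_rayXiG_le (K := K) (p := p) T.ne_bot hCL0 hCL
  obtain ⟨C₂, hC₂0, hC₂⟩ := exists_norm_rayXiG_le (K := K) (p := p) T.ne_bot hCL'0 hCL'
  obtain ⟨A, hA0, hA⟩ := Stark1974.exists_mul_add_rpow_le (μ := 7 / 4) (μ' := 15 / 8) (c := 1)
    (a := 1) (by norm_num) (by norm_num) zero_le_one zero_le_one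
  refine ⟨max C₁ C₂ * Real.exp A, by positivity, fun s ↦ ?_⟩
  have key : ∀ (M : ℂ → ℂ) (CM : ℝ), CM ≤ max C₁ C₂ →
      (∀ w : ℂ, 1 / 2 ≤ w.re → ‖rayXiG K 𝔣 p M w‖ ≤ CM * Real.exp (‖w‖ ^ (7 / 4 : ℝ))) →
      ∀ w : ℂ, 1 / 2 ≤ w.re → ‖w‖ ≤ 1 + ‖s‖ →
        ‖rayXiG K 𝔣 p M w‖ ≤ max C₁ C₂ * Real.exp A * Real.exp (‖s‖ ^ (15 / 8 : ℝ)) := by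
    intro M CM hCM hM w hw hws
    have h1 := hM w hw
    have h2 : ‖w‖ ^ (7 / 4 : ℝ) ≤ ‖s‖ ^ (15 / 8 : ℝ) + A := by
      have := hA ‖s‖ (norm_nonneg s)
      rw [one_mul] at this
      exact (Real.rpow_le_rpow (norm_nonneg _) hws (by norm_num)).trans this
    have hCM0 : 0 ≤ CM := by
      have := (norm_nonneg _).trans h1
      have hexp : 0 < Real.exp (‖w‖ ^ (7 / 4 : ℝ)) := Real.exp_pos _
      nlinarith [this, hexp, le_max_left C₁ C₂]
    calc ‖rayXiG K 𝔣 p M w‖ ≤ CM * Real.exp (‖w‖ ^ (7 / 4 : ℝ)) := h1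
      _ ≤ max C₁ C₂ * Real.exp (‖s‖ ^ (15 / 8 : ℝ) + A) := by gcongr
      _ = max C₁ C₂ * Real.exp A * Real.exp (‖s‖ ^ (15 / 8 : ℝ)) := by rw [Real.exp_add]; ring
  by_cases h : 1 / 2 ≤ s.re
  · have : T.xi s = rayXiG K 𝔣 p T.L s := by simp only [xi, h, if_true]
    rw [this]
    exact key T.L C₁ (le_max_left _ _) hC₁ s h (by linarith [norm_nonneg s])
  · have : T.xi s = T.W * rayXiG K 𝔣 p T.L' (1 - s) := by simp only [xi, h, if_false]
    rw [this, norm_mul, T.norm_W, one_mul]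
    push Not at h
    refine key T.L' C₂ (le_max_right _ _) hC₂ (1 - s) (by simp; linarith) ?_
    calc ‖1 - s‖ ≤ ‖(1 : ℂ)‖ + ‖s‖ := norm_sub_le _ _
      _ = 1 + ‖s‖ := by simp

/-- `ξ(s) ≠ 0` for `Re s > 1`. [cite: ThornerZaman2017, §2.2] -/
theorem xi_ne_zero_of_one_lt_re {s : ℂ} (hs : 1 < s.re) : T.xi s ≠ 0 := by
  rw [T.xi_eq_of_re_pos (by linarith)]
  exact rayXiG_ne_zero T.ne_bot hs (T.L_ne_zero s hs)

/-- `ξ(s) ≠ 0` for `Re s < 0` (functional equation). [cite: ThornerZaman2017, §2.2] -/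
theorem xi_ne_zero_of_re_neg {s : ℂ} (hs : s.re < 0) : T.xi s ≠ 0 := by
  have h := T.xi_one_sub (1 - s)
  rw [sub_sub_cancel] at h
  rw [h]
  exact mul_ne_zero T.W_ne_zero (T.swap.xi_ne_zero_of_one_lt_re (by simp; linarith))

/-- The zeros of `ξ` lie in `0 ≤ Re s ≤ 1`. [cite: ThornerZaman2017, §2.2] -/
theorem re_mem_of_xi_eq_zero {s : ℂ} (hs : T.xi s = 0) : 0 ≤ s.re ∧ s.re ≤ 1 := by
  constructor
  · by_contra h; push Not at h; exact T.xi_ne_zero_of_re_neg h hs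
  · by_contra h; push Not at h; exact T.xi_ne_zero_of_one_lt_re h hs

/-- `ξ(1) = 0` (the factor `s − 1`; `L` is entire). [cite: ThornerZaman2017, §2.2] -/
theorem xi_one : T.xi 1 = 0 := by
  rw [T.xi_eq_of_re_pos (by simp), rayXiG_one]

/-- A zero `ρ` of `L` with `Re ρ > 0` is a zero of `ξ`. [cite: ThornerZaman2017, §2.2] -/
theorem xi_eq_zero_of_L_eq_zero {ρ : ℂ} (hρ : 0 < ρ.re) (h : T.L ρ = 0) : T.xi ρ = 0 := by
  rw [T.xi_eq_of_re_pos hρ]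
  exact rayXiG_eq_zero_of_eq_zero h

/-- `ξ(s) = s(s−1) A^{s/2} L_∞(s) L(s)` for `Re s > 0`. [cite: NeukirchANT1999, Ch. VII §8 Cor. (8.6)] -/
theorem xi_eq_mul {s : ℂ} (hs : 0 < s.re) :
    T.xi s = s * (s - 1) * (((rayCond K 𝔣 : ℝ) : ℂ) ^ (s / 2) * rayClassGammaFactor K p s * T.L s) := by
  rw [T.xi_eq_of_re_pos hs, rayXiG]

end RayXiData

/-! ### Construction from the primitive data of a ray class character -/

/-- The right half-plane with the point `1` removed is preconnected (union of four convex pieces).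
[folklore] -/
private theorem isPreconnected_re_pos_diff_one : IsPreconnected ({z : ℂ | 0 < z.re} \ {1}) := by
  -- four convex pieces
  set H₁ : Set ℂ := {z : ℂ | 0 < z.re} ∩ {z : ℂ | 0 < z.im} with hH₁
  set H₂ : Set ℂ := {z : ℂ | 0 < z.re} ∩ {z : ℂ | z.im < 0} with hH₂
  set R : Set ℂ := {z : ℂ | 1 < z.re} with hR
  set Lf : Set ℂ := {z : ℂ | 0 < z.re} ∩ {z : ℂ | z.re < 1} with hLf
  have hc₁ : Convex ℝ H₁ := (convex_halfSpace_re_gt 0).inter (convex_halfSpace_im_gt 0)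
  have hc₂ : Convex ℝ H₂ := (convex_halfSpace_re_gt 0).inter (convex_halfSpace_im_lt 0)
  have hcR : Convex ℝ R := convex_halfSpace_re_gt 1
  have hcL : Convex ℝ Lf := (convex_halfSpace_re_gt 0).inter (convex_halfSpace_re_lt 1)
  have hp₁ : IsPathConnected H₁ := hc₁.isPathConnected ⟨2 + I, by simp [hH₁]⟩
  have hp₂ : IsPathConnected H₂ := hc₂.isPathConnected ⟨2 - I, by simp [hH₂]⟩
  have hpR : IsPathConnected R := hcR.isPathConnected ⟨2, by simp [hR]⟩
  have hpL : IsPathConnected Lf := hcL.isPathConnected ⟨1 / 2, by norm_num [hLf]⟩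
  have hU₁ : IsPathConnected (H₁ ∪ R) := hp₁.union hpR ⟨2 + I, by simp [hH₁, hR]⟩
  have hU₂ : IsPathConnected (H₁ ∪ R ∪ H₂) := hU₁.union hp₂ ⟨2 - I, by simp [hH₂, hR]⟩
  have hU₃ : IsPathConnected (H₁ ∪ R ∪ H₂ ∪ Lf) :=
    hU₂.union hpL ⟨1 / 2 + I, by norm_num [hH₁, hLf]⟩
  have heq : H₁ ∪ R ∪ H₂ ∪ Lf = {z : ℂ | 0 < z.re} \ {1} := by
    ext z
    simp only [hH₁, hR, hH₂, hLf, mem_union, mem_inter_iff, mem_setOf_eq, Set.mem_sdiff, mem_singleton_iff]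
    constructor
    · rintro (((⟨h1, h2⟩ | h) | ⟨h1, h2⟩) | ⟨h1, h2⟩)
      · exact ⟨h1, fun h ↦ by rw [h] at h2; simp at h2⟩
      · exact ⟨show 0 < z.re by linarith, fun h' ↦ by rw [h'] at h; simp at h⟩
      · exact ⟨h1, fun h ↦ by rw [h] at h2; simp at h2⟩
      · exact ⟨h1, fun h ↦ by rw [h] at h2; simp at h2⟩
    · rintro ⟨h0, h1⟩
      rcases lt_trichotomy z.im 0 with him | him | him
      · exact Or.inl (Or.inr ⟨h0, him⟩)
      · rcases lt_trichotomy z.re 1 with hre | hre | hre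
        · exact Or.inr ⟨h0, hre⟩
        · exact absurd (Complex.ext (by simpa using hre) (by simpa using him)) h1
        · exact Or.inl (Or.inl (Or.inr hre))
      · exact Or.inl (Or.inl (Or.inl ⟨h0, him⟩))
  rw [← heq]
  exact hU₃.isConnected.isPreconnected

namespace RayClassPrimitiveData

variable {𝔪 : Ideal (𝓞 K)} {ψ : HeightOneSpectrum (𝓞 K) → ℂ} (D : RayClassPrimitiveData 𝔪 ψ)

/-- The conjugate continuation `L̄(s) = conj L(conj s)` of `L(s, χ̄₀)`. [cite: NeukirchANT1999, Ch. VII §8 (8.1)] -/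
def Lconj (s : ℂ) : ℂ := conj (D.L (conj s))

/-- `L̄` is entire. [cite: NeukirchANT1999, Ch. VII §8 Thm. (8.5)] -/
theorem differentiable_Lconj : Differentiable ℂ D.Lconj := fun z ↦
  differentiableAt_conj_conj_iff.mpr (D.differentiable (conj z))

/-- `L̄(s) = L(s, χ̄₀)` for `Re s > 1`. [cite: NeukirchANT1999, Ch. VII §8 (8.1)] -/
theorem Lconj_eq {s : ℂ} (hs : 1 < s.re) : D.Lconj s = rayClassLSeries D.𝔣 (star D.χ₀) s := by
  have hs' : 1 < (conj s).re := by rwa [conj_re]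
  rw [Lconj, D.L_eq _ hs', show star D.χ₀ = fun v ↦ conj (D.χ₀ v) from rfl,
    rayClassLSeries_conj D.ne_bot D.norm_le_one hs]

/-- Non-principality of `χ̄₀`. [cite: NeukirchANT1999, Ch. VII §8 Thm. (8.5)] -/
theorem nontrivial_star (hnt : ∃ v : HeightOneSpectrum (𝓞 K), ¬ 𝔪 ≤ v.asIdeal ∧ ψ v ≠ 1) :
    ∃ v : HeightOneSpectrum (𝓞 K), ¬ D.𝔣 ≤ v.asIdeal ∧ star D.χ₀ v ≠ 1 := by
  obtain ⟨v, hv, hv1⟩ := D.nontrivial hnt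
  refine ⟨v, hv, fun h ↦ hv1 ?_⟩
  have : conj (D.χ₀ v) = 1 := h
  rw [← Complex.conj_conj (D.χ₀ v), this, map_one]

/-- Polynomial growth of `L` on `Re s ≥ 1/2`. [cite: ThornerZaman2019, Lemma 2.5] -/
theorem growth_L (hnt : ∃ v : HeightOneSpectrum (𝓞 K), ¬ 𝔪 ≤ v.asIdeal ∧ ψ v ≠ 1) :
    ∃ C : ℝ, 0 ≤ C ∧ ∀ s : ℂ, 1 / 2 ≤ s.re → ‖D.L s‖ ≤ C * (‖s‖ + 5 / 2) ^ Module.finrank ℚ K := by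
  refine ⟨(|(discr K : ℝ)| * (Ideal.absNorm D.𝔣 : ℝ)) * Real.exp (2 * Module.finrank ℚ K), by positivity,
    fun s hs ↦ (D.norm_L_le hnt (by linarith)).trans ?_⟩
  gcongr
  calc ‖s + 5 / 2‖ ≤ ‖s‖ + ‖(5 / 2 : ℂ)‖ := norm_add_le _ _
    _ = ‖s‖ + 5 / 2 := by norm_num

/-- Polynomial growth of `L̄` on `Re s ≥ 1/2`. [cite: ThornerZaman2019, Lemma 2.5] -/
theorem growth_Lconj (hnt : ∃ v : HeightOneSpectrum (𝓞 K), ¬ 𝔪 ≤ v.asIdeal ∧ ψ v ≠ 1) :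
    ∃ C : ℝ, 0 ≤ C ∧ ∀ s : ℂ, 1 / 2 ≤ s.re → ‖D.Lconj s‖ ≤ C * (‖s‖ + 5 / 2) ^ Module.finrank ℚ K := by
  obtain ⟨C, hC0, hC⟩ := D.growth_L hnt
  refine ⟨C, hC0, fun s hs ↦ ?_⟩
  rw [Lconj, Complex.norm_conj]
  have := hC (conj s) (by rwa [conj_re])
  rwa [Complex.norm_conj] at this

/-- `L̄(s) ≠ 0` for `Re s > 1`. [cite: ThornerZaman2017, Lemma 5.3] -/
theorem Lconj_ne_zero (hnt : ∃ v : HeightOneSpectrum (𝓞 K), ¬ 𝔪 ≤ v.asIdeal ∧ ψ v ≠ 1) {s : ℂ}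
    (hs : 1 < s.re) : D.Lconj s ≠ 0 := by
  rw [Lconj, Ne, map_eq_zero_iff _ (RingHom.injective _)]
  exact D.L_ne_zero_of_one_le_re hnt (by rw [conj_re]; exact hs.le)

/-- **The functional equation transferred to the entire continuations**: with Hecke's root number `W`
(`rayClassLSeries_functional_equation'`), `G_L(1 − s) = W G_{L̄}(s)` on the strip `0 < Re s < 1`
(identity theorem on the right half-plane minus `{1}`, twice). [cite: NeukirchANT1999, Ch. VII §8 Cor. (8.6)] -/
theorem exists_rootNumber :
    ∃ W : ℂ, ‖W‖ = 1 ∧ ∀ s : ℂ, 0 < s.re → s.re < 1 →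
      rayXiG K D.𝔣 D.p D.L (1 - s) = W * rayXiG K D.𝔣 D.p D.Lconj s := by
  obtain ⟨W, Λ, Λ', hW, -, -, hΛd, hΛ'd, hΛ, hΛ', hfe⟩ :=
    rayClassLSeries_functional_equation' D.isRayClassCharacter D.isPrimitive D.isSignType D.ne_bot
  refine ⟨W, hW, ?_⟩
  -- the domain
  set U : Set ℂ := {z : ℂ | 0 < z.re} \ {1} with hU
  have hUo : IsOpen U := (isOpen_lt continuous_const continuous_re).sdiff isClosed_singleton
  have hUpc : IsPreconnected U := isPreconnected_re_pos_diff_one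
  have hUsub : U ⊆ ({0, 1} : Set ℂ)ᶜ := by
    rintro z ⟨hz0, hz1⟩
    have hz0' : 0 < z.re := hz0
    simp only [mem_compl_iff, mem_insert_iff, mem_singleton_iff, not_or]
    exact ⟨fun h ↦ by rw [h, zero_re] at hz0'; exact lt_irrefl _ hz0', hz1⟩
  have h2U : (2 : ℂ) ∈ U := ⟨by simp, by simp⟩
  -- `z(z−1)Λ(z) = G_L(z)` on `U`, and the same for `Λ'`, `L̄`
  have key : ∀ (M : ℂ → ℂ) (N : ℂ → ℂ) (χ : HeightOneSpectrum (𝓞 K) → ℂ), DifferentiableOn ℂ M ({0, 1}ᶜ : Set ℂ) →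
      (∀ s : ℂ, 1 < s.re → M s = completedRayClassL K D.𝔣 χ D.p s) → Differentiable ℂ N →
      (∀ s : ℂ, 1 < s.re → N s = rayClassLSeries D.𝔣 χ s) →
      EqOn (fun z ↦ z * (z - 1) * M z) (rayXiG K D.𝔣 D.p N) U := by
    intro M N χ hMd hM hN hNs
    have hFd : DifferentiableOn ℂ (fun z ↦ z * (z - 1) * M z) U :=
      ((differentiableOn_id.mul (differentiableOn_id.sub_const 1)).mul (hMd.mono hUsub))
    have hGd : DifferentiableOn ℂ (rayXiG K D.𝔣 D.p N) U := fun z hz ↦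
      (differentiableAt_rayXiG hN D.ne_bot hz.1).differentiableWithinAt
    refine AnalyticOnNhd.eqOn_of_preconnected_of_eventuallyEq (𝕜 := ℂ) (hFd.analyticOnNhd hUo)
      (hGd.analyticOnNhd hUo) hUpc h2U ?_
    refine eventually_of_mem ((continuous_re.isOpen_preimage _ isOpen_Ioi).mem_nhds (by simp : 1 < (2 : ℂ).re))
      fun t (ht : 1 < t.re) ↦ ?_
    show t * (t - 1) * M t = rayXiG K D.𝔣 D.p N t
    rw [hM t ht, rayXiG_eq_completed hNs ht]
  have hA := key Λ D.L D.χ₀ hΛd hΛ D.differentiable D.L_eq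
  have hB := key Λ' D.Lconj (star D.χ₀) hΛ'd hΛ' D.differentiable_Lconj (fun s hs ↦ D.Lconj_eq hs)
  intro s hs0 hs1
  have hsU : s ∈ U := ⟨hs0, fun h ↦ by rw [h, one_re] at hs1; exact lt_irrefl _ hs1⟩
  have h1sU : (1 - s) ∈ U := ⟨by simp; linarith, fun h ↦ by
    have := congrArg Complex.re h; simp at this; linarith⟩
  have e1 := hA h1sU
  have e2 := hB hsU
  simp only [] at e1 e2
  rw [← e1, ← e2, hfe s]
  ring

/-- The root number of the primitive associate (Hecke). [cite: NeukirchANT1999, Ch. VII §8 Thm. (8.5)] -/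
def rootNumber : ℂ :=
  Classical.choose D.exists_rootNumber

/-- **The analytic data of the primitive associate**: `L = D.L`, `L' = L̄ = conj ∘ L ∘ conj`, `W` = Hecke's root
number. [cite: NeukirchANT1999, Ch. VII §8 Cor. (8.6)] -/
def xiData (hnt : ∃ v : HeightOneSpectrum (𝓞 K), ¬ 𝔪 ≤ v.asIdeal ∧ ψ v ≠ 1) : RayXiData K D.𝔣 D.p where
  L := D.L
  L' := D.Lconj
  W := D.rootNumber
  ne_bot := D.ne_bot
  differentiable_L := D.differentiable
  differentiable_L' := D.differentiable_Lconj
  norm_W := (Classical.choose_spec D.exists_rootNumber).1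
  growth_L := D.growth_L hnt
  growth_L' := D.growth_Lconj hnt
  L_ne_zero := fun _ hs ↦ D.L_ne_zero_of_one_le_re hnt hs.le
  L'_ne_zero := fun _ hs ↦ D.Lconj_ne_zero hnt hs
  fe := (Classical.choose_spec D.exists_rootNumber).2

/-- Unfolding: the first function of the data is `D.L`. [cite: NeukirchANT1999, Ch. VII §8 Cor. (8.6)] -/
@[simp] theorem xiData_L (hnt : ∃ v : HeightOneSpectrum (𝓞 K), ¬ 𝔪 ≤ v.asIdeal ∧ ψ v ≠ 1) :
    (D.xiData hnt).L = D.L := rfl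

/-- Unfolding: the second function of the data is `L̄`. [cite: NeukirchANT1999, Ch. VII §8 Cor. (8.6)] -/
@[simp] theorem xiData_L' (hnt : ∃ v : HeightOneSpectrum (𝓞 K), ¬ 𝔪 ≤ v.asIdeal ∧ ψ v ≠ 1) :
    (D.xiData hnt).L' = D.Lconj := rfl

/-- A REAL zero `β` of `L` is a zero of `L̄` (`L̄(β) = conj L(β)`). [cite: ThornerZaman2017, §7.2] -/
theorem Lconj_ofReal_eq_zero {β : ℝ} (h : D.L β = 0) : D.Lconj β = 0 := by
  rw [Lconj, Complex.conj_ofReal, h, map_zero]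

end RayClassPrimitiveData

end Literature.NumberTheory.LFunctions

end
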